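import Mathlib
import HarnessLib
import HarnessLib.Audit
import Summits.AtomisticToContinuum.Statement
import Literature.MathematicalPhysics.QuantumManyBody.PeriodicBoseGas
import HarnessLib.Audit.Status.Attr

/-!
Route: BECPopovBerryRG

# Route BECPopovBerryRG — Popov after blocking, Berry phases as complex defect activities, GK x FS
stiff-phase engine (OS-real class)

It suffices to show X = BerryStiffPhaseOS ∧ BlockOccupationLD ∧ PolarTransferOS ∧
BoundaryTransferWeak (conforming gen-2 successor
of route BECPolarBlockRG, retired 13:39Z as not-a-thesis; realises card
popov-polar-blocking-irrelevant-rg; engine REPAIRED twice on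
2026-08-15: rev 2 — BerryStiffPhaseLRO = stmt-AtomisticToContinuum-14490 refuted-misstated (free
set-function large fields), superseded by
BerryStiffPhaseLROR = stmt-13942 with (i) polymer factorisation, (ii) U(1) invariance; rev 4
(route-choice seat) — a third witness family
(U(1)-invariant complex TIME-ODD remainder ⇒ θ₁-null of the temporal-winding sum, WITNESS3.md on
13942) shows (i)+(ii) still misstate the
class, so the NEXT LINE adds (iii) OS/reflection reality: BerryStiffPhaseOS, PolarTransferOS,
Assembly re-pointed).
BerryStiffPhaseOS (ENGINE, a Literature-grade lattice theorem with no Bose-gas input): on the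
(3+1)-torus, every compact-phase weight given
in the Gawedzki–Kupiainen / Balaban small-field–large-field format — bond factors with a
near-Gaussian core of stiffness K_i ∈ [K, ΛK]
(cubic/quartic irrelevant slop), a Peierls floor ‖B(η)‖ ≤ 2e^(−K(1−cos η)/2), an imaginary Berry
term iδ∂_τθ with integral total offset
δ(#sites) ∈ ℤ, a COMPLEX local remainder dominated by ε₀·K·(local XY energy), L^∞-small large-field
activities e^(−K|F|) that FACTORISE
over R-separated pieces, every datum invariant under the global shift θ ↦ θ + a AND OS-real (the
time-reflected configuration carries the
complex-conjugate weight, as for any Hermitian transfer operator) — has Z ≠ 0 and equal-time order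
|⟨cos(θ_x − θ_y)·O_x·O_y⟩ − 1| ≤ C/√K
for all local, shift-invariant, OS-real insertions O vanishing to first order, uniformly in the
volume and the time extent.
BlockOccupationLD: block-occupation deficits of near-minimisers are volume-order large deviations.
PolarTransferOS (THE BET):
BlockOccupationLD → BerryStiffPhaseOS → BlockPhaseCoherence (uniform pairwise coherence ≥ cρℓ³ of
all Fournais-scale blocks of every
near-minimiser on the torus). BoundaryTransferWeak (shared stmt-AtomisticToContinuum-0827): periodic
constant-mode BEC ⇒ Dirichlet
HasGroundStateBEC. Glue BlockPhaseCoherence ⇒ PeriodicBEC is bilinearity of the occupation form.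
Lean: `BerryStiffPhaseOS ∧ BlockOccupationLD ∧ PolarTransferOS ∧ BoundaryTransferWeak`

## Assembly
Pure logic (theorem `closes` in glue.lean, certified native; also `assembly_holds` in Sketch.lean,
rc 0, no sorry): given
hE : BerryStiffPhaseOS, hLD : BlockOccupationLD, hT : PolarTransferOS, hG :
BlockCoherenceToPeriodicBEC, hB : BoundaryTransferWeak and v
repulsive finite-range, `hB v hv (hG (hT hLD hE) v hv)` is the body of the sub-problem Statement
`_root_.BoseEinsteinCondensation`
(∃ρ₀ > 0 ∀ρ ∈ (0,ρ₀) HasGroundStateBEC v ρ). Every crux is a hypothesis of `closes`; the target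
BlockPhaseCoherence and the milestone
QuarticPerturbedXYLRO are deliberately not.

Rationale: WHY THIS LINE. Popov after blocking: in POLAR block variables at a scale ℓ with ξ ≪ ℓ ≤ ξ(ρa³)^(−ε')
(inside the Fournais window, where block
condensation and LHY-precision block energies are theorems: Fournais2020, FournaisSolovej2020,
LiebSeiringerYngvason2005) the amplitude
is massive and its zero set a large deviation (BlockOccupationLD), while the compact block phase is
a (3+1)-D lattice field at stiffness
K ≍ (ℓ/ξ)²(ρa³)^(−1/2) → ∞ whose remaining couplings are all irrelevant in d+1 = 4, z = 1 (Popov;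
PistolesiEtAl2004; DupuisRancon2011;
the scope caveat (ii) of
Literature.Barriers.AtomisticToContinuum.BogoliubovPerturbationInfraredNarrow) — instead of the
strictly
renormalisable Cartesian 'elliptic regime' of BFKT2017 (arXiv:1609.00968 §1.3) with its open
large-field problem (route BECRenormGroup).
The non-real part of the blocked action is exactly (a) the Berry term i n̄∂_τθ (a pure phase on
phase-slip membranes after the integer shift
n̄ = n₀ + δ, trivial on the global winding because N ∈ ℤ; Sachdev2011 Ch. 2/9, FisherEtAl1989) and
(b) the Galilean cubic −(i c₃)∂_τθ(∇θ)²,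
c₃/K ≍ ξ/ℓ → 0, dominated by the local XY energy; so the engine is stated for COMPLEX weights in the
small-field/large-field format of
constructive RG (GawedzkiKupiainen1980, GawedzkiKupiainen1983, Balaban1995, BalabanOcarroll1999,
Dimock2013), where convergent expansions —
unlike Ginibre / reflection positivity / duality-positivity (FrohlichSimonSpencer1976,
FrohlichSpencerCMP1982, KennedyKing1986,
arXiv:2002.02946, GarbanSpencer2022, DarioGarban2025) — do not care whether activities are real.
Imported area: constructive lattice RG for
massless Gaussian fixed points approached along irrelevant directions plus Fröhlich–Spencer
vortex-sheet energy–entropy bounds, and the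
quantum-rotor/Bose–Hubbard Berry-phase bookkeeping (dictionary block ↦ rotor site, ρℓ³ ↦ offset
charge n̄, (ℓ/ξ)²(ρa³)^(−1/2) ↦ E_J/E_C).
REPAIR HISTORY (the engine is an adversarial CLASS theorem; each refutation so far located a
structural property of the delivered model that
the class had not recorded, none touched the mechanism). Rev 2: BerryStiffPhaseLRO (stmt-14490)
refuted-misstated by
Theorems.BECPopovBerryRGBerryStiffPhaseLRO_refuted — free set-function large-field activities
(negative singletons g_{x} ≡ −Z_∅/Σ_yΨ_y)
cancel Z once V ≥ e^K; repaired as BerryStiffPhaseLROR (stmt-13942) with (i) POLYMER FACTORISATION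
of g over R-separated pieces (KoteckyPreiss1986;
Scott–Sokal cancellations of non-factorised families excluded, ScottSokal2005) and (ii) GLOBAL U(1)
INVARIANCE of w, g, O, P (kills the repair
seat's second family w_x = itε₀K·e_x·cos θ_x ⇒ Z = ∫e^(−KE)J₀(…) changes sign). Rev 4 (route-choice
seat, this revision): a THIRD family honouring
(i)+(ii) — the U(1)-invariant, R = 1 local, energy-dominated complex TIME-ODD remainder w_x =
ε₀K(c+ic')(1 − cos η_{x,1})·sin η_{x,τ}: for
V_s = (m+2)³ ≳ 1/ε₀ and N_τ = n+2 ≳ 2πK/ε₀ its real part tilts the temporal-winding weights e^(−ak²)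
(a = 2π²KV_s/N_τ) to be symmetric about
k = −1/2 (c = 2πK/(ε₀N_τ)) while its imaginary part, a field-dependent half-integer Berry offset (c'
= 1/(ε₀V_s)), signs them (−1)^k, so
Z ∝ Σ_k (−1)^k e^(−a(k+1/2)²) = 0 — a θ₁-null; Z is entire in the coefficient so the zero is exact
(Hurwitz); toy-exact transfer-matrix numerics
(WITNESS3.md attached to 13942: simple zero at γ = 0.50005 − 0.50063i, |Z|/Σ|terms| = 7·10⁻¹³,
winding number 1). The missing structure is
(iii) OS / REFLECTION REALITY: the delivered weight comes from a Hermitian transfer operator, so for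
every time reflection R_t(s,τ) = (s,2t−τ)
the reflected configuration carries the conjugate weight — w_{R_t x}(θ∘R_t) = conj w_x(θ) (symmetric
site assignment of bond terms; the
Galilean cubic is imaginary AND time-odd), g_{R_t F}(θ∘R_t) = conj g_F(θ), insertions likewise
through their slice. (iii) forces c = 0; the
sector sums of the OS-real class are θ₃'s with real argument (positive by Poisson), spatial-winding
analogues would need an imaginary
time-even term (forbidden), mixed sectors factor into positive θ₃'s. BerryStiffPhaseOS :=
BerryStiffPhaseLROR + (iii); PolarTransferOS and
the Assembly/closes re-pointed; 13942/13943 leave the file as superseded records (13942 carries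
WITNESS3.md; its formal negation is worth an
idle refuter's Hurwitz argument but is not an item of this route). ROUTE-CHOICE CONFIRMATIONS of rev
4 (no statement change): g2 KREIN.md (OS-reality = J-self-adjointness of the
pair-slice transfer operator; dominant spectrum positive Krein type), g3 CHOICE-g3.md (Z real for
every member; negative charge-sector traces
unreachable), g4 CHOICE-g4.md (degenerate tori n = 0 / m = 0, sign-indefinite spatial tails, large
charges, free bond phase, staggered w,
half filling: no cheap 4th witness) — all attached to stmt-13936.

RANKED CRUXES. #0 BlockPhaseCoherence (target) — uniform mesoscopic phase coherence on the torus
(card item (4); verbatim the gen-1 target):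
for every repulsive finite-range v there is ρ₀ > 0 such that for 0 < ρ < ρ₀ there are c > 0 and a
block window 0 < ℓ₀, 2ℓ₀ ≤ ℓ₁ with: for
all large N there is δ > 0 such that every periodic trial state Ψ on the torus of side L =
(N/ρ)^(1/3) with periodicEnergy ≤ E₀^per + δ
satisfies, for every block number m with ℓ = L/m ∈ [ℓ₀, ℓ₁] and every pair of blocks z, z', occ(φ_z
+ φ_z') ≥ occ(φ_z) + occ(φ_z') + 2cρℓ³
(polarisation form of Re⟨φ_z, γ_Ψ φ_z'⟩ ≥ cρℓ³). (why it might fail: stronger than the open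
PeriodicBEC, uniform over all block pairs; needs
δ below the block Josephson energy ≍ ρℓ; v ≡ 0 gives equality with c = 1/2.)
[LiebSeiringerSolovejYngvason2005, Fournais2020, Junge2026]
#2 BerryStiffPhaseOS (crux) — ENGINE, OS-REAL CLASS (rev 4; supersedes 13942 ⊃ 14490). For Λ ≥ 1, R
∈ ℕ there are ε₀, K₀, C > 0 such that
for K ≥ K₀, all tori (ℤ/(m+2))³ × ℤ/(n+2), stiffnesses K ≤ K_i ≤ ΛK, Berry offset |δ| ≤ 1/2 with
δ(m+2)³ ∈ ℤ, bond factors B_i : ℝ → ℂ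
(measurable, 2π-periodic, spatial real even, temporal B(−η) = conj B(η)) with Gaussian core
exp(−K_iη²/2 + iδη·[temporal] + u),
|u| ≤ Kη²(ε₀|η| + Λη²) on |η| ≤ 1/(4Λ), Peierls floor ‖B_i(η)‖ ≤ 2e^(−K(1−cos η)/2), complex range-R
remainders |w_x| ≤ ε₀K·Σ_(y near x) e_y,
large-field activities g_F (g_∅ = 1, local near F, ‖g_F‖ ≤ e^(−K|F|), multiplicative over
R-separated unions), w, g, O, P invariant under
θ ↦ θ + a, and OS-real: w_{R_t x}(θ∘R_t) = conj w_x(θ), g_{R_t F}(θ∘R_t) = conj g_F(θ) for all t,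
O(θ∘R_{t₀}) = conj O(θ), P likewise
(t₀ = x.2 = y.2): the weight wt = Σ_F g_F·Π_(bonds avoiding F) B·e^(−Σ_(x∉F) w_x) has Z = ∫wt ≠ 0
and ‖∫cos(θ_x − θ_y)·O·P·wt − Z‖ ≤ (C/√K)‖Z‖
for equal-time x, y and local insertions |O − 1|, |P − 1| ≤ Σ_near √e. Members: cosine/Villain XY,
offset-Villain (Bose–Hubbard) temporal bond,
wrong-sign quartics, imaginary Galilean cubic; no RP, no Ginibre, no positivity; the three recorded
witness families are excluded by
hypothesis. [difficulty: open-problem] (why it might fail: LRO for complex OS-real perturbations of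
MASSLESS 4-D XY without positivity needs a
convergent multiscale expansion in which polymers interact via spin waves; measurable data, bond
phases at |η| ~ K^(−1/3), sectors at n ≫ K.)
[FrohlichSpencerCMP1982, GawedzkiKupiainen1980, GawedzkiKupiainen1983, Balaban1995,
BalabanOcarroll1999, Dimock2013, KoteckyPreiss1986,
OsterwalderSchrader1973, Sachdev2011]
#3 BlockOccupationLD (crux) — amplitude zeros are large deviations (verbatim the gen-1 item): for
every repulsive finite-range v there is ρ₀ > 0
such that for 0 < ρ < ρ₀ and every deficit fraction η ∈ (0,1) there are c, ℓ₀ > 0 with: for all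
large N there is δ > 0 such that for every
δ-near-minimiser Ψ on the torus of side L = (N/ρ)^(1/3), every block number m with ℓ = L/m ≥ ℓ₀ and
every block z, the |Ψ|²-probability that
block z holds at most (1 − η)ρℓ³ particles is ≤ exp(−cρℓ³) — the large-field input of
PolarTransferOS (activity e^(−cρℓ³) ≤ e^(−K) since
ρℓ³/K ≍ ℓ/ξ → ∞). [difficulty: L] (why it might fail: the lower-tail rate of a superfluid ground
state is not in print; phonon fluctuations
Var N_B ∝ ℓ² log ℓ control only small deficits; a coexistence-type cavity would cost only exp(−cℓ²);
near-minimisers need δ ≲ gap·e^(−cN).)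
[AstrakharchikCombescotPitaevskii2007, KlawunnEtAl2011, TorquatoStillinger2003,
LiebSeiringerSolovejYngvason2005, FournaisSolovej2020]
#4 PolarTransferOS (crux) — THE BET re-pointed (supersedes PolarTransferR = stmt-13943 ⊃ 14492):
BlockOccupationLD → BerryStiffPhaseOS →
BlockPhaseCoherence. Intended proof: Fournais-window blocks ℓ = C_L(ρa³)^(−δ')(ρa)^(−1/2), m = L/ℓ,
slabs τ₀ = ℓ/c_s (E_J ≍ ρℓ vs E_C ≍ 8πa/ℓ³,
isotropic up to Λ = O(1)), thermal state at β = (n+2)τ₀ then n → ∞ (ground state; δ-near-minimisers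
via the fixed-(N,L) gap), block
number–phase variables with integer block numbers summed EXACTLY at a tuned block chemical potential
(n₀ = round⟨n_B⟩, δ = ⟨n_B⟩ − n₀,
δm³ ∈ ℤ, K_τ = Var n_B), offset-Villain temporal bond, real even near-cosine spatial bonds,
remainder = imaginary Galilean cubic + wrong-sign
quartic with ε₀ ≍ ξ/ℓ, deficient block-slabs as large fields, √n factors as insertions (coefficient
K_τ/n̄ ≍ ξ/ℓ); membership: (i) indicator
expansions multiply over disjoint sets, (ii) everything depends on phase differences, (iii) the
representation is a time-slicing of the
Hermitian Tr e^(−βH), bond terms assigned half to each endpoint, so reflected configurations carry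
conjugate weights termwise (needs R ≥ 1 for
the forward-energy bound). Then Re⟨a*(φ_z)a(φ_z')⟩ ≥ ρℓ³(1 − O(√(ρa³)) − C/√K) ≥ cρℓ³ uniformly.
[deps: BerryStiffPhaseOS, BlockOccupationLD]
[difficulty: open-problem] (why it might fail: delivered remainder is exponentially, not finitely,
ranged; grand-canonical block sums must be
matched to N-body near-minimisers; one-mode reduction of a*(φ_z) needs correlation control;
OS-symmetric indexing must survive the cumulant
re-exponentiation.) [arXiv:1609.00968, BalabanEtAl2010, Benfatto1994, PistolesiEtAl2004,
DupuisRancon2011, Fournais2020, FournaisSolovej2020]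
#5 BoundaryTransferWeak (crux) — SHARED verbatim with stmt-AtomisticToContinuum-0827 (home
BECPeriodicReduction; one proof serves all sharing
routes): PeriodicBEC(v) ⇒ ∃ρ₀ > 0 ∀ρ ∈ (0,ρ₀) HasGroundStateBEC v ρ. Expected proof: Neumann
bracketing of interior sub-boxes + a mode-free
criterion (λ_max ≥ tr γ²/N); only the ENERGY analogue is in print (LSSY2005 Ch. 2 after (2.8)).
[difficulty: L] (why it might fail:
PeriodicBEC(v) is ground-state-only at the box (N/ρ)^(1/3); the Dirichlet ground state lies a wall
term ≫ δ above E₀^per, so the hypothesis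
may never fire; BEC is b.c.-sensitive (Robinson1976).) [LiebSeiringerSolovejYngvason2005, Junge2026,
Basti2022, BoccatoSeiringer2023, Robinson1976]
#9 QuarticPerturbedXYLRO (support) — MILESTONE 0 of the engine (real member, Λ = 1, R = 1): the
(3+1)-torus XY model with cosine bonds of
stiffness K plus ONE site-local measurable perturbation |W| ≤ ε₀K(Σ_i(1 − cos η_i)² + (1 − cos τ)²)
of either sign (not RP, not Ginibre) has
equal-time ⟨cos(θ_x − θ_y)⟩ ≥ 1 − C/K for K ≥ K₀, all m, n. [difficulty: XL]
[FrohlichSpencerCMP1982, GarbanSpencer2022, BalabanOcarroll1999]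
#9 BlockCoherenceToPeriodicBEC (support) — GLUE: BlockPhaseCoherence ⇒ PeriodicBEC (body of
stmt-0826 = hypothesis of BoundaryTransferWeak):
m = ⌈L/ℓ₁⌉, constantMode = m^(−3/2)Σ_z φ_z, bilinearity of cellOccupation gives condensateOccupation
≥ (c/2)N. [difficulty: M]

TWO-LAYER PLAN. Foreseen glued splits (none filed; k ≤ 3, depth 1). BerryStiffPhaseOS ⇐
RealSmallFieldLRO (g ≡ 1_(F=∅), real OS weights, δ = 0:
the QuarticPerturbedXYLRO regime widened to the (Λ, R) class by one GK-type expansion) →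
ComplexActivityExtension (same expansion with complex
OS-real w, Berry phases on phase-slip membranes, large-field polymers of activity e^(−K|F|); new
input: |Z| > 0 from convergence) → BerryStiffPhaseOS;
an RP-IN-TIME sub-class (weights from a positive transfer operator, Z > 0 for free, spectral
representation of temporal decay) is the natural
first rung if a prover wants one. PolarTransferOS ⇐ OffsetVillainRepresentation (the blocked torus
gas at ρ < ρ₀ written EXACTLY as a member of
the OS-real class up to exponentially small tails) → InsertionControl (⟨a*(φ_z)a(φ_z')⟩ =
ρℓ³·⟨cos·O·P⟩ with admissible OS-real symmetrised
insertions) → PolarTransferOS; if the delivered remainder is only exponentially local the engine is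
widened by `--resplit` (R ↦ decay rate),
never the remainder truncated. BlockOccupationLD ⇐ exact-ground-state version → near-minimiser
stability via the fixed-(N,L) gap.
BoundaryTransferWeak: owned by the routes sharing stmt-0827.

KILL CRITERIA. K1 (fired twice as class misstatements: rev 2 free set-function g; rev 4 time-odd
complex w — each repaired by recording a
structural property of the delivered model): BerryStiffPhaseOS refuted by an explicit admissible
member ⇒ if the witness exploits a FURTHER
unrecorded structure of the delivered model (time-translation covariance, analyticity of bonds, RP
in time of the un-re-exponentiated
representation) the line is NOT restated a third time as a class: the planner replaces the class
engine by the CONCRETE blocked-model engine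
(offset-Villain temporal bond, near-cosine spatial bonds, Galilean cubic + quartic with |c₃|,|c₄| ≤
ε₀K, indicator large fields) or closes
refuted:BerryStiffPhaseOS; if the witness is a genuine OS-real, U(1)-invariant, factorised member
with smooth bonds, or if even the real member
QuarticPerturbedXYLRO dies, close refuted. K2: the cheapest falsifier shows an imaginary coupling of
the blocked action that is neither the
Berry term, nor ε₀-dominated with ε₀ → 0, nor confined to large-field regions, or one that is NOT
OS-real under symmetric assignment ⇒
PolarTransferOS is back in BFKT's complex large-field class; close as superseded by a Cartesian RG
route (BECRenormGroup). K3: BlockOccupationLD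
refuted (rate sub-volume and < K per block-slab) ⇒ pivot PolarTransferOS to a vortex-density
argument or close. K4: BlockPhaseCoherence
refuted for some admissible v at arbitrarily small ρ kills this route and every block-phase card.
K5: ¬BoundaryTransferWeak kills the route,
not the conjunct (shared). PeriodicBEC proved by any route moots PolarTransferOS.

NOT DECOMPOSED YET. The number–phase / Trotter representation of the blocked continuum gas as a Lean
object (PolarTransferOS's prover builds
it under Theorems; a definition item only once the representation is fixed); exponential versus
finite range of the delivered remainder;
the constants (Fournais exponents, ε₀(Λ,R), K₀, Λ); positive temperature; general dimension (only
the (3+1)-torus is typed); the Dirichlet-box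
version of the blocking (BoundaryTransferWeak is a black box); analyticity/smoothness of admissible
bonds and RP-in-time / time-translation
covariance as further sub-class restrictions (the engine is stated for measurable OS-real data; a
prover may land a sub-class first as a
support lemma); the formal negation of the superseded 13942 (Hurwitz argument of WITNESS3.md) —
negative knowledge worth an idle refuter,
not load-bearing here.

CHEAPEST FALSIFIER. (i) Re-run the three recorded witness families against BerryStiffPhaseOS (all
fail its hypotheses by construction: free
g is not multiplicative; ie_x cos θ_x is not U(1); the θ₁ tilt needs a REAL time-odd w, not
OS-real). (ii) The sector caricature is closed
(θ₃ with real arguments); the next cheapest attack is an exact charge-basis transfer-matrix numeric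
for m = 0 (8-site slices), odd n+2 ∈
{3,5}, OS-real but sign-indefinite temporal bond tails and rough in-core slop u (|Im u| ≤
Kη²(ε₀|η|+Λη²), odd), hunting for NEGATIVE transfer
eigenvalues within a factor (n+2)-th-root of the top one — the caricature bounds them by
O(ε₀K^(−1/2) + Λ/K)·λ_max. (iii) One-loop bookkeeping
of the block action with signs of i tracked (done by hand, see Numbers) — what would still kill
cheaply: a generated single-bond odd term
i·c(∂_τθ)³ with |c| ≫ ε₀K, or any term that is not OS-real under symmetric site assignment. (iv) The
real member QuarticPerturbedXYLRO with
the wrong sign at K = 1…4 on 8⁴ tori is a half-day Monte-Carlo kit job for a refuter (real weights,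
sign-problem free). (v) Degenerate tori are closed (CHOICE-g4.md): at n = 0 the
reflections are the identity, so (iii) makes w, g, O, P REAL and temporal bonds pair to |B₃|² ≥ 0;
at m = 0 spatial bonds pair to B_i² ≥ 0;
with w = 0, g = 1_(F=∅), m = 0 and EVEN n+2, Z = Tr of an even power of a Hermitian operator ≥ 0
identically — so a witness must use odd n+2
or w ≠ 0, g ≠ 1_(F=∅), m ≥ 1. (vi) Sign-indefinite REAL spatial tails (m ≥ 1; the floor exceeds the
Gaussian continuation just outside |η| ≤ 1/(4Λ)):
#∂S is even for every site set S, so plateaux are positive and odd tail counts are neutral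
ramp/dipole large fields of activity
±e^(−cK/Λ²), c ≈ 0.1 — digestible by the expansion whatever their sign; negative spatial-winding
sectors cost e^(−0.75K·#bonds). (vii) The
in-core slop bound leaves the bond PHASE free for |η| ≳ (π/KΛ)^(1/4) (probability e^(−c√K)) and
b₃(q) may be negative only for |q−δ| ≳ K^(3/4)
(|b₃| ≤ e^(−c√K)): both are small signed activities, not cancellation levers. The structural road
left is KREIN's top-of-sector Krein
collision for odd n+2, which needs field strengths where w is no longer e-small, i.e. large fields —
multi-scale by nature.

NUMBERS. Fournais window: ℓ = C_L(ρa³)^(−δ')(ρa)^(−1/2), condensation for ⟨Ψ,HΨ⟩ ≤ 4πaρN +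
C₀aρ(ρa³)^(1/2−ε)N when 2δ' + ε < 1/2
(Fournais2020_condensation, proved in tree); ξ = (8πρa)^(−1/2); E_J ≍ ρℓ, E_C ≍ 8πa/ℓ³, τ₀ = (E_J
E_C)^(−1/2) ≍ ℓξ; K = E_Jτ₀ ≍ (ℓ/ξ)²(ρa³)^(−1/2)
→ ∞; n̄ = ρℓ³ ≫ K ≫ 1 (n̄/K ≍ ℓ/ξ); K_τ/n̄ ≍ ξ/ℓ; c₃/K ≍ ξ/ℓ; c₄/K ≍ (ξ/ℓ)²; depletion O(√(ρa³))
(FournaisSolovej2020); LD rate c·n̄ with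
c < h(η) = η + (1−η)log(1−η); offset-Villain bond Σ_n e^(inφ−(n−n̄)²/2K) = √(2πK)Σ_q
e^(in̄(φ−2πq))e^(−K(φ−2πq)²/2), |n̄-dependence of the
q-sum| ≤ 2e^(−2π²K); power counting in 3+1, z = 1: (∂_τθ)(∇θ)² dim 6, (∇θ)⁴ dim 8, (∂θ)³ dim 6 (all
irrelevant); Peierls floor constant
(1 − cos 1)/2 = 0.23; β_c(4D XY) ≈ 0.30. One-loop block action: L_E = iδn∂_τθ + (ρ₀+δn)(∇θ)²/2m +
gδn²/2 ⇒ S = (1/2g)(∂_τθ)² + (ρ₀/2m)(∇θ)²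
− (i/2gm)∂_τθ(∇θ)² − (1/8gm²)(∇θ)⁴ + iρ₀∂_τθ (OS-real termwise: the odd-in-∂_τθ terms are exactly
the imaginary ones). Witness numbers:
rev-2 family J₀ minimum −0.403 at 3.832 with V ≈ 7.7/(tε₀); rev-4 family a = 2π²KV_s/N_τ, c =
2πK/(ε₀N_τ), c' = 1/(ε₀V_s), toy zero at
γ = 0.5000548 − 0.5006270i for K' = 400, N = 2513 (|Z|/Σ|terms| = 7·10⁻¹³, winding number 1). Items
after rev 4: 8 active (1 target,
4 cruxes, 2 support, 1 assembly) + superseded records 14490 (refuted), 14492, 13942, 13943.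

DEFINITION REQUESTS. None filed: block modes, block sets, the torus lattice, the reflections R_t,
bond/remainder/large-field data and
insertions are inlined (EuclideanSpace / Set.indicator / Finset sums and images over (Fin 3 → Fin
(m+2)) × Fin (n+2));
Literature.MathematicalPhysics.QuantumManyBody.BoseGas.{PeriodicTrialState, periodicEnergy,
periodicGroundStateEnergy, cellOccupation,
condensateOccupation, cellN, Config, sideLength, IsRepulsiveFiniteRange, HasGroundStateBEC} and
`_root_.BoseEinsteinCondensation` exist
(Sketch.lean rc 0). A `StiffPhaseClass` structure under Literature/Probability/LatticeModels
packaging (B, w, g, δ) + the three structural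
axioms would shorten BerryStiffPhaseOS and is worth a definition item once a second route wants the
same class.

Novelty: Searches (2026-08-15, this seat; `lit search`/`lit frontier` were unavailable — searchd rc 75 at
18:4xZ and 19:0xZ, recorded in NOTES.md —
so broad discovery ran on `lit galaxy search … --star all`): "low temperature expansion for
classical N-vector models" (6 rows: Dimock
arXiv:1108.1335 = Dimock2013, Les Houches 2010 volume, Peled–Spinka arXiv:1708.00058, Külske
math-ph/9812021); "massless lattice theories"
(7 rows: Fröhlich (ed.) Scaling and Self-Similarity = GawedzkiKupiainen1983's venue,
Malyshev–Minlos, Glimm–Jaffe, Hao Shen AHP 2016 dipole-gas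
RG doi:10.1007/s00023-015-0417-x); "Massless phases and symmetry restoration" (9 rows:
FrohlichSpencerCMP1982 citers incl. Dario–Wu
arXiv:2002.02946, Correggi–Giuliani–Seiringer, Mariani thesis); "Berry phase term" (12 rows, all
condensed-matter textbooks: Sachdev2011,
Coleman, Mudry, Fradkin, Wen — no rigorous treatment); "quantum rotor model" (12 rows, textbooks);
"Berry phase term in the Bose-Hubbard",
"vortex loops in the three-dimensional XY model", "without reflection positivity", "dual of the XY
model in four dimensions" (0 rows each);
in-book Sachdev2011 "Berry phase" → Ch. 2 p. (chars 254000) 'complex-valued Boltzmann weights …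
Berry phases are complex even in imaginary
time'; inherited from gen-1 (same card, 11:42Z): `lit frontier AtomisticToContinuum --since 2020`
(30 rows, none on polar/hydrodynamic RG),
`lit bridges --cross any` (30 rows, no Bose-gas × lattice-spin bridge), crossref Balaban N-vector (7
hits), vsearch  [refs: 10.1007/s00023-015-0417-x, 1108.1335, 1708.00058, 2002.02946, 1609.00968, doi:10.1007/s00023-015-0417-x, Dimock2013, GawedzkiKupiainen1983, FrohlichSpencerCMP1982, Sachdev2011, BFKT2017, BalabanEtAl2010, Balaban1995, BalabanOcarroll1999, DarioWu2020, FisherEtAl1989, WallinEtAl1994]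

Barriers (technique_class: polar-block-rg irrelevant-ops vortex-sheets complex-activity): - technique_class: polar-block-rg irrelevant-ops vortex-sheets complex-activity
- Literature.Barriers.AtomisticToContinuum.BogoliubovPerturbationInfrared: evaded by construction —
no expansion in the particle (Cartesian) representation; the Goldstone field enters only through
gradients (vertex order s = 2, finite in d = 3); residual honesty: convergence (not n!-asymptotics)
is exactly what BerryStiffPhaseLRO must supply.
- Literature.Barriers.AtomisticToContinuum.BogoliubovPerturbationInfraredNarrow: its scope caveat
(ii) (phase–amplitude expansions IR-finite term by term) is the route; what it leaves — the
large-field problem and the non-real action — is relocated into BlockOccupationLD (amplitude zeros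
as large-field polymers of activity e^(−cρℓ³)) and into the complex-activity format of the engine
(Berry phases ride on phase-slip membranes of cost ≥ cK·area).
- Literature.Barriers.AtomisticToContinuum.KineticGapLengthScales: respected — the kinetic gap is
used only INSIDE blocks of side ℓ ≤ ξ(ρa³)^(−ε') (Fournais window, where it is a theorem);
inter-block coherence comes from the gap-free lattice engine, a correlation statement.
- Literature.Barriers.AtomisticToContinuum.KineticGapLengthScalesNarrow: BlockPhaseCoherence /
PeriodicBEC are energy-window statements with δ chosen AFTER N (far below the boost cost 4π²N/L²),
so the Galilei-boost witnesses do not fire; the proof is a representation + correlation argument on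
the thermal/ground state transferred to near-minimisers

History (route lifecycle, newest last):
- 2026-08-15T20:18:50Z · BROKEN — BerryStiffPhaseLRO (stmt-AtomisticToContinuum-14490, crux) refuted by Summit.AtomisticToContinuum.BoseEinsteinCondensation.Theorems.BECPopovBerryRGBerryStiffPhaseLRO_refuted @ e3ca7d8cf07a (refuter-rreview-0815T19-21-0)
- 2026-08-15T20:38:25Z · rev 2: restated BerryStiffPhaseLRO (stmt-AtomisticToContinuum-14490 refuted), PolarTransfer (stmt-AtomisticToContinuum-14492), Assembly (stmt-AtomisticToContinuum-14495) — repair: BerryStiffPhaseLRO (stmt-AtomisticToContinuum-14490, crux) refuted-misstated by Theorems.BECPopovBerryRGBerryStiffPhaseLRO_refuted (free set (planner-rfix-AtomisticToContinuum-BECPopovBe-334a406e-0)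
- 2026-08-15T20:38:25Z · REPAIRED (restate BerryStiffPhaseLRO, PolarTransfer, Assembly) — back to open: repair: BerryStiffPhaseLRO (stmt-AtomisticToContinuum-14490, crux) refuted-misstated by Theorems.BECPopovBerryRGBerryStiffPhaseLRO_refuted (free set-function la (planner-rfix-AtomisticToContinuum-BECPopovBe-334a406e-0)
- 2026-08-15T23:20:33Z · rev 4: restated BerryStiffPhaseLROR (stmt-AtomisticToContinuum-13942), PolarTransferR (stmt-AtomisticToContinuum-13943), Assembly (stmt-AtomisticToContinuum-13944) — route-choice (unit rchoice-…-cae07ddb): NEXT LINE. The rev-2 engine BerryStiffPhaseLROR (13942) still admits a class-boundary witness honouring (i) factor (planner-rchoice-AtomisticToContinuum-BECPopovB-cae07ddb-0)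

sub-problem: BoseEinsteinCondensation · status: open · opened planner-plancard-AtomisticToContinuum-BoseEin-5451e747-g2-0 2026-08-15T19:09:01Z · rev 5 · ledger route-AtomisticToContinuum-BECPopovBerryRG
GENERATED by the gate from the ledger (D-0016/17). Provers cite these decls: `theorem foo : Summit.AtomisticToContinuum.BoseEinsteinCondensation.Theses.BECPopovBerryRG.<Decl> := …` in Summits/AtomisticToContinuum/BoseEinsteinCondensation/Theorems/<Name>.lean.
-/

namespace Summit.AtomisticToContinuum.BoseEinsteinCondensation.Theses.BECPopovBerryRG

open scoped BigOperators Topology Manifold Classical MeasureTheory ProbabilityTheory Matrix InnerProductSpace ComplexConjugate ContinuousMap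
open Filter Set Function TopologicalSpace MeasureTheory

attribute [summit_statement] _root_.BoseEinsteinCondensation

/-- item stmt-AtomisticToContinuum-14489 · target · rank 0 · open · by planner
why it might fail: Stronger than the open PeriodicBEC (uniform over all block pairs up to distance L); needs δ below the block Josephson energy ≍ ρℓ so that no near-minimiser hides a phase-twisted region; v ≡ 0 gives equality with c = 1/2.
sources: LiebSeiringerSolovejYngvason2005, Fournais2020, Junge2026, Summits/AtomisticToContinuum/BoseEinsteinCondensation/Ideas/popov-polar-blocking-irrelevant-rg.md
[target] uniform mesoscopic phase coherence on the torus (card item (4); verbatim the gen-1 target):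
for every repulsive finite-range v there is ρ₀ > 0 such that for 0 < ρ < ρ₀ there are c > 0 and a
block window 0 < ℓ₀, 2ℓ₀ ≤ ℓ₁ with: for all large N there is δ > 0 such that every periodic trial
state Ψ on the torus of side L = (N/ρ)^(1/3) with periodicEnergy ≤ E₀^per + δ satisfies, for every
block number m with ℓ = L/m ∈ [ℓ₀, ℓ₁] and every pair of blocks z, z' (normalised block modes φ_z =
ℓ^(−3/2)·1_block), occ(φ_z + φ_z') ≥ occ(φ_z) + occ(φ_z') + 2cρℓ³ — the polarisation form of Re⟨φ_z,
γ_Ψ φ_z'⟩ ≥ cρℓ³ (z = z' is block condensation). Strictly stronger than PeriodicBEC (pairwise, not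
averaged). -/
@[route_item "route-AtomisticToContinuum-BECPopovBerryRG"]
def BlockPhaseCoherence : Prop :=
  ∀ v : ℝ → ENNReal, Literature.MathematicalPhysics.QuantumManyBody.BoseGas.IsRepulsiveFiniteRange v → ∃ ρ₀ : ℝ, 0 < ρ₀ ∧ ∀ ρ : ℝ, 0 < ρ → ρ < ρ₀ → ∃ c ℓ₀ ℓ₁ : ℝ, 0 < c ∧ 0 < ℓ₀ ∧ 2 * ℓ₀ ≤ ℓ₁ ∧ ∀ᶠ N : ℕ in Filter.atTop, ∃ δ : ENNReal, 0 < δ ∧ ∀ Ψ : Literature.MathematicalPhysics.QuantumManyBody.BoseGas.PeriodicTrialState N (Literature.MathematicalPhysics.QuantumManyBody.BoseGas.sideLength ρ N), Literature.MathematicalPhysics.QuantumManyBody.BoseGas.periodicEnergy v Ψ ≤ Literature.MathematicalPhysics.QuantumManyBody.BoseGas.periodicGroundStateEnergy v N (Literature.MathematicalPhysics.QuantumManyBody.BoseGas.sideLength ρ N) + δ → ∀ m : ℕ, 0 < m → let L := Literature.MathematicalPhysics.QuantumManyBody.BoseGas.sideLength ρ N; let ℓ := L / m; ℓ₀ ≤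 ℓ → ℓ ≤ ℓ₁ → let φ : (Fin 3 → Fin m) → EuclideanSpace ℝ (Fin 3) → ℂ := fun z => ({x : EuclideanSpace ℝ (Fin 3) | ∀ k, x k ∈ Set.Ico (((z k : ℕ) : ℝ) * ℓ) ((((z k : ℕ) : ℝ) + 1) * ℓ)}).indicator (fun _ => ((Real.sqrt (ℓ ^ 3))⁻¹ : ℂ)); ∀ z z' : Fin 3 → Fin m, Literature.MathematicalPhysics.QuantumManyBody.BoseGas.cellOccupation N L (φ z) Ψ.ψ + Literature.MathematicalPhysics.QuantumManyBody.BoseGas.cellOccupation N L (φ z') Ψ.ψ + ENNReal.ofReal (2 * c * ρ * ℓ ^ 3) ≤ Literature.MathematicalPhysics.QuantumManyBody.BoseGas.cellOccupation N L (fun x => φ z x + φ z' x) Ψ.ψ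

/-- item stmt-AtomisticToContinuum-13936 · crux · rank 2 · open · by planner
why it might fail: LRO for complex OS-real perturbations of MASSLESS 4-D XY without positivity: needs a convergent multiscale expansion with polymers interacting via spin waves; measurable data, bond phases at |η| ~ K^(−1/3), sectors at n ≫ K; three class-boundary witnesses already.
sources: FrohlichSpencerCMP1982, GawedzkiKupiainen1980, GawedzkiKupiainen1983, Balaban1995, BalabanOcarroll1999, Dimock2013
[crux] ENGINE, OS-REAL CLASS (rev 4; supersedes BerryStiffPhaseLROR =
stmt-AtomisticToContinuum-13942, itself the rev-2 repair of the refuted-misstated BerryStiffPhaseLRO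
= stmt-AtomisticToContinuum-14490). Same Gawedzki–Kupiainen × Fröhlich–Spencer stiff-phase engine
for COMPLEX weights in small-field/large-field format: for Λ ≥ 1, R ∈ ℕ there are ε₀, K₀, C > 0 such
that for K ≥ K₀, all tori (ℤ/(m+2))³ × ℤ/(n+2), stiffnesses K ≤ K_i ≤ ΛK, Berry offset |δ| ≤ 1/2
with δ(m+2)³ ∈ ℤ, bond factors B_i (measurable, 2π-periodic, spatial real even, temporal B(−η) =
conj B(η)) with Gaussian core exp(−K_iη²/2 + iδη·[temporal] + u), |u| ≤ Kη²(ε₀|η| + Λη²) on |η| ≤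
1/(4Λ), Peierls floor ‖B_i(η)‖ ≤ 2e^(−K(1−cos η)/2), complex range-R remainders |w_x| ≤ ε₀K·Σ_(y
near x) e_y and large-field activities g_F (g_∅ = 1, local near F, ‖g_F‖ ≤ e^(−K|F|)), the weight wt
= Σ_F g_F·Π_(bonds avoiding F) B·e^(−Σ_(x∉F) w_x) has Z ≠ 0 and ‖∫cos(θ_x − θ_y)·O·P·wt − Z‖ ≤
(C/√K)‖Z‖ for equal-time x, y and local insertions |O−1|, |P−1| ≤ Σ_near √e — under THREE structural
hypotheses, all automatic for the blocked Bose gas: (i) POLYMER FACTORISATION g_(F₁∪F₂) =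
g_(F₁)g_(F₂) over R-separated pieces; (ii) GLOBAL U(1) -/
@[route_item "route-AtomisticToContinuum-BECPopovBerryRG", crux]
def BerryStiffPhaseOS : Prop :=
  ∀ Λ : ℝ, 1 ≤ Λ → ∀ R : ℕ, ∃ ε₀ K₀ C : ℝ, 0 < ε₀ ∧ 0 < K₀ ∧ 0 < C ∧ ∀ K : ℝ, K₀ ≤ K → ∀ m n : ℕ, ∀ Kd : Fin 4 → ℝ, (∀ i, K ≤ Kd i ∧ Kd i ≤ Λ * K) → ∀ δ : ℝ, |δ| ≤ 1 / 2 → (∃ z : ℤ, δ * ((m + 2 : ℕ) : ℝ) ^ 3 = (z : ℝ)) → ∀ B : Fin 4 → ℝ → ℂ, (∀ i, Measurable (B i)) → (∀ i η, B i (η + 2 * Real.pi) = B i η) → (∀ i : Fin 3, ∀ η, B (Fin.castSucc i) (-η) = B (Fin.castSucc i) η ∧ (B (Fin.castSucc i) η).im = 0) → (∀ η, B (Fin.last 3) (-η) = (starRingEnd ℂ) (B (Fin.last 3) η)) → (∀ i η, |η| ≤ 1 / (4 * Λ) → ∃ u : ℂ, ‖u‖ ≤ K * η ^ 2 * (ε₀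 * |η| + Λ * η ^ 2) ∧ B i η = Complex.exp (((-(Kd i * η ^ 2 / 2) : ℝ) : ℂ) + ((if i = Fin.last 3 then δ * η else 0 : ℝ) : ℂ) * Complex.I + u)) → (∀ i η, |η| ≤ Real.pi → ‖B i η‖ ≤ 2 * Real.exp (-(K * (1 - Real.cos η) / 2))) → let near : ((Fin 3 → Fin (m + 2)) × Fin (n + 2)) → ((Fin 3 → Fin (m + 2)) × Fin (n + 2)) → Prop := fun x y => (∀ i, ((y.1 i - x.1 i : Fin (m + 2)) : ℕ) ≤ R ∨ ((x.1 i - y.1 i : Fin (m + 2)) : ℕ) ≤ R) ∧ (((y.2 - x.2 : Fin (n + 2)) : ℕ) ≤ R ∨ ((x.2 - y.2 : Fin (n + 2)) : ℕ) ≤ R); let e : ((Fin 3 → Fin (m + 2)) × Fin (n + 2)) → (((Fin 3 → Fin (m + 2)) × Fin (n + 2)) → ℝ) → ℝ := fun s θ => (∑ i : Fin 3, (1 - Real.cos (θ (s.1 + Pi.single i 1, s.2) - θ s))) + (1 - Real.cos (θ (s.1, s.2 + 1) - θ s)); let refl : Fin (n + 2) → ((Fin 3 → Fin (m + 2)) ×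 Fin (n + 2)) → ((Fin 3 → Fin (m + 2)) × Fin (n + 2)) := fun t s => (s.1, t + (t - s.2)); ∀ w : ((Fin 3 → Fin (m + 2)) × Fin (n + 2)) → (((Fin 3 → Fin (m + 2)) × Fin (n + 2)) → ℝ) → ℂ, (∀ x, Measurable (w x)) → (∀ x θ y, w x (θ + Pi.single y (2 * Real.pi)) = w x θ) → (∀ x θ θ', (∀ y, near x y → θ y = θ' y) → w x θ = w x θ') → (∀ x θ, ‖w x θ‖ ≤ ε₀ * K * ∑ y, if near x y then e y θ else 0) → (∀ x θ (a : ℝ), w x (fun s => θ s + a) = w x θ) → (∀ t x θ, w (refl t x) (fun s => θ (refl t s)) = (starRingEnd ℂ) (w x θ)) → ∀ g : Finset ((Fin 3 → Fin (m + 2)) × Fin (n + 2)) → (((Fin 3 → Fin (m + 2)) × Fin (n + 2)) → ℝ) → ℂ, (∀ F, Measurable (g F)) → (∀ θ, g ∅ θ = 1) → (∀ F θ θ', (∀ y, (∃ x ∈ F, near x y) → θ y = θ' y) → g F θ = g F θ') → (∀ F θ, ‖g F θ‖ ≤ Real.exp (-(K * F.card))) → (∀ F θ (a : ℝ), g F (fun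 s => θ s + a) = g F θ) → (∀ F₁ F₂ θ, (∀ x ∈ F₁, ∀ y ∈ F₂, ¬ near x y) → g (F₁ ∪ F₂) θ = g F₁ θ * g F₂ θ) → (∀ t F θ, g (F.image (refl t)) (fun s => θ (refl t s)) = (starRingEnd ℂ) (g F θ)) → let wt : (((Fin 3 → Fin (m + 2)) × Fin (n + 2)) → ℝ) → ℂ := fun θ => ∑ F : Finset ((Fin 3 → Fin (m + 2)) × Fin (n + 2)), g F θ * (∏ s : ((Fin 3 → Fin (m + 2)) × Fin (n + 2)), (∏ i : Fin 3, if s ∉ F ∧ (s.1 + Pi.single i 1, s.2) ∉ F then B (Fin.castSucc i) (θ (s.1 + Pi.single i 1, s.2) - θ s) else 1) * (if s ∉ F ∧ (s.1, s.2 + 1) ∉ F then B (Fin.last 3) (θ (s.1, s.2 + 1) - θ s) else 1)) * Complex.exp (-∑ x ∈ Fᶜ, w x θ); let Z : ℂ := ∫ θ in Set.pi Set.univ (fun _ : ((Fin 3 → Fin (m + 2)) × Fin (n + 2)) => Set.Ico (0 : ℝ) (2 * Real.pi)), wt θ; Z ≠ 0 ∧ ∀ x y : ((Fin 3 → Fin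 (m + 2)) × Fin (n + 2)), x.2 = y.2 → ∀ O P : (((Fin 3 → Fin (m + 2)) × Fin (n + 2)) → ℝ) → ℂ, Measurable O → Measurable P → (∀ θ θ', (∀ s, near x s → θ s = θ' s) → O θ = O θ') → (∀ θ θ', (∀ s, near y s → θ s = θ' s) → P θ = P θ') → (∀ θ, ‖O θ - 1‖ ≤ ∑ s, if near x s then Real.sqrt (e s θ) else 0) → (∀ θ, ‖P θ - 1‖ ≤ ∑ s, if near y s then Real.sqrt (e s θ) else 0) → (∀ θ (a : ℝ), O (fun s => θ s + a) = O θ) → (∀ θ (a : ℝ), P (fun s => θ s + a) = P θ) → (∀ θ, O (fun s => θ (refl x.2 s)) = (starRingEnd ℂ) (O θ)) → (∀ θ, P (fun s => θ (refl x.2 s)) = (starRingEnd ℂ) (P θ)) → ‖(∫ θ in Set.pi Set.univ (fun _ : ((Fin 3 → Fin (m + 2)) × Fin (n + 2)) => Set.Ico (0 : ℝ) (2 * Real.pi)), (Real.cos (θ x - θ y) : ℂ) * O θ * P θ * wt θ) - Z‖ ≤ C / Real.sqrt K * ‖Z‖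

/-- item stmt-AtomisticToContinuum-14491 · crux · rank 3 · open · by planner
why it might fail: The lower-tail rate of a superfluid ground state is not in print: phonon-dominated fluctuations Var N_B ∝ ℓ² log ℓ (Astrakharchik–Combescot–Pitaevskii) control only small deficits; a coexistence-type cavity would cost only exp(−cℓ²); near-minimisers need δ ≲ gap·e^(−cN).
sources: AstrakharchikCombescotPitaevskii2007, KlawunnEtAl2011, TorquatoStillinger2003, LiebSeiringerSolovejYngvason2005, FournaisSolovej2020
[crux] amplitude zeros are large deviations (card item (b); verbatim the gen-1 item): for every
repulsive finite-range v there is ρ₀ > 0 such that for 0 < ρ < ρ₀ and every deficit fraction η ∈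
(0,1) there are c, ℓ₀ > 0 with: for all large N there is δ > 0 such that for every δ-near-minimiser
Ψ of the periodic energy on the torus of side L = (N/ρ)^(1/3), every block number m with ℓ = L/m ≥
ℓ₀ and every block z, the |Ψ|²-probability (on the fundamental cell) that block z holds at most (1 −
η)ρℓ³ particles is ≤ exp(−cρℓ³). Volume-order lower tail (v ≡ 0 is the binomial tail, c < h(η) = η +
(1−η)log(1−η)); it is the large-field input of PolarTransfer: a block-slab with deficient occupation
is a large-field region of activity e^(−cρℓ³) ≤ e^(−K) since ρℓ³/K ≍ ℓ/ξ → ∞. [difficulty: L] -/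
@[route_item "route-AtomisticToContinuum-BECPopovBerryRG", crux]
def BlockOccupationLD : Prop :=
  ∀ v : ℝ → ENNReal, Literature.MathematicalPhysics.QuantumManyBody.BoseGas.IsRepulsiveFiniteRange v → ∃ ρ₀ : ℝ, 0 < ρ₀ ∧ ∀ ρ : ℝ, 0 < ρ → ρ < ρ₀ → ∀ η : ℝ, 0 < η → η < 1 → ∃ c ℓ₀ : ℝ, 0 < c ∧ 0 < ℓ₀ ∧ ∀ᶠ N : ℕ in Filter.atTop, ∃ δ : ENNReal, 0 < δ ∧ ∀ Ψ : Literature.MathematicalPhysics.QuantumManyBody.BoseGas.PeriodicTrialState N (Literature.MathematicalPhysics.QuantumManyBody.BoseGas.sideLength ρ N), Literature.MathematicalPhysics.QuantumManyBody.BoseGas.periodicEnergy v Ψ ≤ Literature.MathematicalPhysics.QuantumManyBody.BoseGas.periodicGroundStateEnergy v N (Literature.MathematicalPhysics.QuantumManyBody.BoseGas.sideLength ρ N) + δ → ∀ m : ℕ, 0 < m → let L := Literature.MathematicalPhysics.QuantumManyBody.BoseGas.sideLength ρ N; let ℓ := L / m; ℓ₀ ≤ ℓ → ∀ z : Fin 3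 → Fin m, ∫⁻ X in {X : Literature.MathematicalPhysics.QuantumManyBody.BoseGas.Config N | X ∈ Literature.MathematicalPhysics.QuantumManyBody.BoseGas.cellN N L ∧ (∑ i, ({x : EuclideanSpace ℝ (Fin 3) | ∀ k, x k ∈ Set.Ico (((z k : ℕ) : ℝ) * ℓ) ((((z k : ℕ) : ℝ) + 1) * ℓ)}).indicator (fun _ => (1 : ℝ)) (X i)) ≤ (1 - η) * ρ * ℓ ^ 3}, (‖Ψ.ψ X‖₊ : ENNReal) ^ 2 ≤ ENNReal.ofReal (Real.exp (-(c * ρ * ℓ ^ 3)))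

/-- item stmt-AtomisticToContinuum-13937 · crux · rank 4 · open · by planner
why it might fail: Delivered remainder is exponentially, not finitely, ranged (intra-block gap ≍ c_s/ℓ); grand-canonical block sums must be matched to N-body near-minimisers; one-mode reduction of a*(φ_z) needs correlation control; OS-symmetric indexing must survive the cumulant re-exponentiation.
sources: arXiv:1609.00968, BFKT2017, BalabanEtAl2010, Benfatto1994, PistolesiEtAl2004, DupuisRancon2011
[crux] THE BET, re-pointed at the OS-real engine (supersedes PolarTransferR =
stmt-AtomisticToContinuum-13943): BlockOccupationLD → BerryStiffPhaseOS → BlockPhaseCoherence.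
Intended proof as before — Fournais-window blocks ℓ = C_L(ρa³)^(−δ')(ρa)^(−1/2), slabs τ₀ = ℓ/c_s,
thermal state at β = (n+2)τ₀ then n → ∞ (ground state; δ-near-minimisers via the fixed-(N,L) gap),
block number–phase variables with integer block numbers summed EXACTLY at a tuned block chemical
potential (n₀ = round⟨n_B⟩, δ = ⟨n_B⟩ − n₀ so δm³ ∈ ℤ, K_τ = Var n_B), offset-Villain temporal bond,
real even near-cosine spatial bonds, remainder = imaginary Galilean cubic + wrong-sign quartic with
ε₀ ≍ ξ/ℓ, deficient block-slabs from BlockOccupationLD as large fields, √n factors as insertions O,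
P (coefficient K_τ/n̄ ≍ ξ/ℓ) — plus the THREE membership checks the engine asks for: (i) the
large-field indicator expansion 1 = Π_x(χ_small + χ_large) is multiplicative over disjoint (a
fortiori R-separated) sets; (ii) every term of the blocked action, every activity and the amplitude
insertions depend on phase DIFFERENCES only (particle-number conservation); (iii) OS-reality: the
representation is a time-slicing of the Hermit -/
@[route_item "route-AtomisticToContinuum-BECPopovBerryRG", crux]
def PolarTransferOS : Prop :=
  BlockOccupationLD → BerryStiffPhaseOS → BlockPhaseCoherence

/-- item stmt-AtomisticToContinuum-0827 · crux · rank 5 · open · by planner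
why it might fail: PeriodicBEC(v) is ground-state-only at the box (N/ρ)^(1/3): the Dirichlet ground state is a periodic trial state but lies a wall term ≫ δ above E₀^per and interior restrictions are neither periodic nor of sharp N, so the hypothesis may never fire; BEC is b.c.-sensitive (Robinson1976).
sources: LiebSeiringerSolovejYngvason2005, Junge2026, Basti2022, BoccatoSeiringer2023, Robinson1976
[crux] BoundaryTransferWeak (mode-free boundary-condition transfer, per potential): for each
repulsive finite-range v, PeriodicBEC(v) implies ∃ρ₀>0 ∀ρ∈(0,ρ₀) HasGroundStateBEC v ρ (Dirichlet
ground state, λ_max(γ) ≥ cN via condensateNumber). Not glue: near-minimiser slacks are O(N/L²) while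
Dirichlet/periodic energies differ by a boundary term ≫ N/L², so no energy-comparison proof;
expected route: Neumann bracketing of interior sub-boxes (−Δ_Dir ≥ ⊕−Δ_Neu, v ≥ 0) + a mode-free
criterion (λ_max ≥ tr γ²/N). Only the ENERGY analogue is in print (LiebSeiringerSolovejYngvason2005
Ch. 2 after (2.8)). v ≡ 0: hypothesis and conclusion both true. -/
@[route_item "route-AtomisticToContinuum-BECPopovBerryRG", crux]
def BoundaryTransferWeak : Prop :=
  ∀ v : ℝ → ENNReal, Literature.MathematicalPhysics.QuantumManyBody.BoseGas.IsRepulsiveFiniteRange v → (∃ ρ₀ : ℝ, 0 < ρ₀ ∧ ∀ ρ : ℝ, 0 < ρ → ρ < ρ₀ → ∃ c : ℝ, 0 < c ∧ ∀ᶠ N : ℕ in Filter.atTop, ∃ δ : ENNReal, 0 < δ ∧ ∀ Ψ : Literature.MathematicalPhysics.QuantumManyBody.BoseGas.PeriodicTrialState N (Literature.MathematicalPhysics.QuantumManyBody.BoseGas.sideLength ρ N), Literature.MathematicalPhysics.QuantumManyBody.BoseGas.periodicEnergy v Ψ ≤ Literature.MathematicalPhysics.QuantumManyBody.BoseGas.periodicGroundStateEnergy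 v N (Literature.MathematicalPhysics.QuantumManyBody.BoseGas.sideLength ρ N) + δ → ENNReal.ofReal (c * N) ≤ Literature.MathematicalPhysics.QuantumManyBody.BoseGas.condensateOccupation N (Literature.MathematicalPhysics.QuantumManyBody.BoseGas.sideLength ρ N) Ψ.ψ) → ∃ ρ₀ : ℝ, 0 < ρ₀ ∧ ∀ ρ : ℝ, 0 < ρ → ρ < ρ₀ → Literature.MathematicalPhysics.QuantumManyBody.BoseGas.HasGroundStateBEC v ρ

/-- item stmt-AtomisticToContinuum-14493 · support · rank 9 · open · by planner
sources: FrohlichSpencerCMP1982, GarbanSpencer2022, BalabanOcarroll1999, GawedzkiKupiainen1980, DarioWu2020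
[support] MILESTONE 0 of the engine (its real member with Λ = 1, R = 1 that already defeats every
printed method; verbatim the gen-1 support item): the (3+1)-torus XY model with cosine bonds of
stiffness K plus ONE site-local perturbation W of the four forward gradients, measurable,
2π-periodic, |W(η,τ)| ≤ ε₀K(Σ_i(1 − cos η_i)² + (1 − cos τ)²) (quartic at zero, mixed directions,
either sign — not reflection positive, not Ginibre), has equal-time ⟨cos(θ_x − θ_y)⟩ ≥ 1 − C/K for K
≥ K₀, all m, n. A prover may land it as a Literature fact under Literature/Probability/LatticeModels
and cite it here. [difficulty: XL] -/
@[route_item "route-AtomisticToContinuum-BECPopovBerryRG"]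
def QuarticPerturbedXYLRO : Prop :=
  ∃ ε₀ K₀ C : ℝ, 0 < ε₀ ∧ 0 < K₀ ∧ 0 < C ∧ ∀ K : ℝ, K₀ ≤ K → ∀ m n : ℕ, ∀ W : (Fin 3 → ℝ) → ℝ → ℝ, Measurable (fun p : (Fin 3 → ℝ) × ℝ => W p.1 p.2) → (∀ η τ, |W η τ| ≤ ε₀ * K * ((∑ i, (1 - Real.cos (η i)) ^ 2) + (1 - Real.cos τ) ^ 2)) → (∀ η τ, ∀ i : Fin 3, W (η + Pi.single i (2 * Real.pi)) τ = W η τ) → (∀ η τ, W η (τ + 2 * Real.pi) = W η τ) → let H : (((Fin 3 → Fin (m + 2)) × Fin (n + 2)) → ℝ) → ℝ := fun θ : ((Fin 3 → Fin (m + 2)) × Fin (n + 2)) → ℝ => ∑ s : ((Fin 3 → Fin (m + 2)) × Fin (n + 2)), (-(K * ((∑ i : Fin 3, Real.cos (θ (s.1 + Pi.single i 1, s.2) - θ s)) + Real.cos (θ (s.1, s.2 + 1) - θ s))) + W (fun i : Fin 3 => θ (s.1 + Pi.single i 1, s.2) - θ s) (θ (s.1, s.2 + 1) - θ s)); ∀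 x y : ((Fin 3 → Fin (m + 2)) × Fin (n + 2)), x.2 = y.2 → (1 - C / K) * ∫ θ in Set.pi Set.univ (fun _ : ((Fin 3 → Fin (m + 2)) × Fin (n + 2)) => Set.Ico (0 : ℝ) (2 * Real.pi)), Real.exp (-H θ) ≤ ∫ θ in Set.pi Set.univ (fun _ : ((Fin 3 → Fin (m + 2)) × Fin (n + 2)) => Set.Ico (0 : ℝ) (2 * Real.pi)), Real.cos (θ x - θ y) * Real.exp (-H θ)

/-- item stmt-AtomisticToContinuum-14494 · support · rank 9 · open · by planner
sources: Fournais2020, LiebSeiringerSolovejYngvason2005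
[support] GLUE: BlockPhaseCoherence ⇒ PeriodicBEC (conclusion verbatim the body of
stmt-AtomisticToContinuum-0826 = the hypothesis of BoundaryTransferWeak). Proof: for large N pick m
= ⌈L/ℓ₁⌉, so L/m ∈ [ℓ₀, ℓ₁] once L ≥ ℓ₁ (uses 2ℓ₀ ≤ ℓ₁) and m ≥ 2; constantMode L = m^(−3/2) Σ_z φ_z
a.e.; cellOccupation is a nonnegative quadratic form in the mode (Fubini on the bounded cell against
a C¹ Ψ), so condensateOccupation = m^(−3) Σ_(z,z') Re⟨φ_z, γφ_z'⟩ ≥ m^(−3)·m³(m³ − 1)·cρ(L/m)³ ≥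
(c/2)ρL³ = (c/2)N. [difficulty: M] -/
@[route_item "route-AtomisticToContinuum-BECPopovBerryRG", crux]
def BlockCoherenceToPeriodicBEC : Prop :=
  BlockPhaseCoherence → ∀ v : ℝ → ENNReal, Literature.MathematicalPhysics.QuantumManyBody.BoseGas.IsRepulsiveFiniteRange v → ∃ ρ₀ : ℝ, 0 < ρ₀ ∧ ∀ ρ : ℝ, 0 < ρ → ρ < ρ₀ → ∃ c : ℝ, 0 < c ∧ ∀ᶠ N : ℕ in Filter.atTop, ∃ δ : ENNReal, 0 < δ ∧ ∀ Ψ : Literature.MathematicalPhysics.QuantumManyBody.BoseGas.PeriodicTrialState N (Literature.MathematicalPhysics.QuantumManyBody.BoseGas.sideLength ρ N), Literature.MathematicalPhysics.QuantumManyBody.BoseGas.periodicEnergy v Ψ ≤ Literature.MathematicalPhysics.QuantumManyBody.BoseGas.periodicGroundStateEnergy v N (Literature.MathematicalPhysics.QuantumManyBody.BoseGas.sideLength ρ N) + δ → ENNReal.ofReal (c * N) ≤ Literature.MathematicalPhysics.QuantumManyBody.BoseGas.condensateOccupation N (Literature.MathematicalPhysics.QuantumManyBody.BoseGas.sideLength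 ρ N) Ψ.ψ

-- earlier Assembly (stmt-AtomisticToContinuum-13944, replaced 2026-08-15T23:20:33Z -> stmt-AtomisticToContinuum-13938): retired by None — BerryStiffPhaseLROR → BlockOccupationLD → PolarTransferR → BlockCoherenceToPeriodicBEC → BoundaryTransferWeak → BoseEinsteinCondensation
-- earlier Assembly (stmt-AtomisticToContinuum-14495, replaced 2026-08-15T20:38:25Z -> stmt-AtomisticToContinuum-13944): retired by None — BerryStiffPhaseLRO → BlockOccupationLD → PolarTransfer → BlockCoherenceToPeriodicBEC → BoundaryTransferWeak → BoseEinsteinCondensation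
/-- item stmt-AtomisticToContinuum-13938 · assembly · rank 1 · open · by planner
sources: LiebSeiringerSolovejYngvason2005, Fournais2020
[assembly] BerryStiffPhaseOS → BlockOccupationLD → PolarTransferOS → BlockCoherenceToPeriodicBEC →
BoundaryTransferWeak → BoseEinsteinCondensation (re-pointed at the rev-4 OS-real engine and
transfer; the deciding theorem `closes` takes exactly these five hypotheses and is pure logic: hB v
hv (hG (hT hLD hE) v hv)). -/
@[route_item "route-AtomisticToContinuum-BECPopovBerryRG"]
def Assembly : Prop :=
  BerryStiffPhaseOS → BlockOccupationLD → PolarTransferOS → BlockCoherenceToPeriodicBEC → BoundaryTransferWeak → BoseEinsteinCondensation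

-- records of items no longer active in this route (dropped / restated):
-- earlier BerryStiffPhaseLROR (stmt-AtomisticToContinuum-13942, replaced 2026-08-15T23:20:33Z -> stmt-AtomisticToContinuum-13936): retired by None — ∀ Λ : ℝ, 1 ≤ Λ → ∀ R : ℕ, ∃ ε₀ K₀ C : ℝ, 0 < ε₀ ∧ 0 < K₀ ∧ 0 < C ∧ ∀ K : ℝ, K₀ ≤ K → ∀ m n : ℕ, ∀ Kd : Fin 4 → ℝ, (∀ i, K ≤ Kd i ∧ Kd i ≤ Λ * K) → ∀ δ : ℝ, |δ| ≤ 1 / 2 → (∃ z : ℤ, δ * ((m + 2 : ℕ) : ℝ) ^ 3 = (z : ℝ)) → ∀ B : Fin 4 → ℝ → ℂ, (∀ i, Measura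
-- earlier PolarTransferR (stmt-AtomisticToContinuum-13943, replaced 2026-08-15T23:20:33Z -> stmt-AtomisticToContinuum-13937): retired by None — BlockOccupationLD → BerryStiffPhaseLROR → BlockPhaseCoherence
-- earlier BerryStiffPhaseLRO (stmt-AtomisticToContinuum-14490, replaced 2026-08-15T20:38:25Z -> stmt-AtomisticToContinuum-13942): refuted by Summit.AtomisticToContinuum.BoseEinsteinCondensation.Theorems.BECPopovBerryRGBerryStiffPhaseLRO_refuted @ e3ca7d8cf07a — ∀ Λ : ℝ, 1 ≤ Λ → ∀ R : ℕ, ∃ ε₀ K₀ C : ℝ, 0 < ε₀ ∧ 0 < K₀ ∧ 0 < C ∧ ∀ K : ℝ, K₀ ≤ K → ∀ m n : ℕ, ∀ Kd : Fin 4 → ℝ, (∀ i, K ≤ Kd i ∧ Kd i ≤ Λ 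
-- earlier PolarTransfer (stmt-AtomisticToContinuum-14492, replaced 2026-08-15T20:38:25Z -> stmt-AtomisticToContinuum-13943): retired by None — BlockOccupationLD → BerryStiffPhaseLRO → BlockPhaseCoherence

/-! D-0027 §2.1 — DECIDING THEOREM (planner-authored via `route open/edit --closes-file`; by planner-rchoice-AtomisticToContinuum-BECPopovB-cae07ddb-0 2026-08-15T23:20:33Z):
its hypotheses are this route's items and its conclusion the sub-problem Statement (glue_lint), and it elaborates with this file. -/

@[closes "route-AtomisticToContinuum-BECPopovBerryRG"] theorem closes (hE : BerryStiffPhaseOS) (hLD : BlockOccupationLD) (hT : PolarTransferOS) (hG : BlockCoherenceToPeriodicBEC) (hB : BoundaryTransferWeak) : _root_.BoseEinsteinCondensation :=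
  fun v hv => hB v hv (hG (hT hLD hE) v hv)

end Summit.AtomisticToContinuum.BoseEinsteinCondensation.Theses.BECPopovBerryRG
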